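import Summits.HodgeConjecture.HodgeConjecture.Theorems.NikulinTwinTransportHodgeSimilitudeAlgebraicLattice
import Summits.HodgeConjecture.HodgeConjecture.Theorems.NikulinTwinTransportTwinSimilitudeAlgebraicMarkings
import Literature.AlgebraicGeometry.Surfaces.K3PeriodSurjectivityProofs
import Literature.AlgebraicGeometry.Surfaces.K3TwistorLines

/-!
# Route NikulinTwinTransport · crux `HodgeSimilitudeAlgebraic` (stmt-HodgeConjecture-13676) —
# line `cm-norm-anchors`, stub `stub_cmNormPeriods_dense`: CM-norm periods are dense

Stub 5 of the skeleton `Cruxes.HodgeSimilitudeAlgebraic.CmNormAnchors` (registered statement, verbatim):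
`∀ q prime, CMNormDense[q]` — the CM-norm periods of multiplier `q` (eigen-periods, with non-real
eigenvalue, of rational `q`-similitudes `J` of `(Λ_ℂ, k3Form)` with rational inverse) are dense, for the
sup metric of `Λ_ℂ = ℂ²²`, among the projective period points; it feeds the engine `stub_twinPropagation`.
Mathematics (elementary; Huybrechts, *Lectures on K3 surfaces* Ch. 6 Prop. 1.5, Iversen, *Hyperbolic
Geometry* Ch. I §2 Prop. 2.3; primality is not used):
* SEED (`exists_cmNormPeriod`, every `n = a²+b²+c²+d² ≥ 1`): on `Λ = E₈(−1)² ⊕ U₁ ⊕ U₂ ⊕ U₃`,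
  `Uₖ = ⟨eₖ, fₖ⟩`, `J` is block diagonal — the quaternion block of the Lattice toolkit on each `E₈(−1)`
  (`e8Block_conj`, used abstractly), `diag(¼, 4n)` on `U₁` (`uBlock_conj`), and the COUPLING
  `C : e₂ ↦ e₃ ↦ −n e₂`, `f₂ ↦ n f₃`, `f₃ ↦ −f₂` on `U₂ ⊕ U₃` (`C² = −n`); `K = J⁻¹` is rational
  (`det J ≠ 0` as `Jᵀ Λ J = n Λ`, `det Λ = −1`). `x₀ = √n e₂ + √n f₂ + i e₃ + i n f₃` has `J x₀ = −i√n x₀`,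
  `x₀² = 0`, `(x̄₀.x₀) = 4n`, `(e₁+f₁ . x₀) = 0`, `(e₁+f₁)² = 2` (a K3 with period `x₀` has CM by `ℚ(√−n)`).
  CM-norm periods (and projective period points) are stable under `x ↦ r x` and under words `g` of
  reflections along lattice vectors (`J ↦ g J g⁻¹`; `cmNormPeriod_prod_k3ReflectionC`).
* TRANSITIVITY (`exists_realReflections_pair`): period points are `a + ib`, `a ⊥ b` real, `a² = b² > 0`
  (`k3Period_re_im`); with `r = √(a²/a₀²)`, Prop. 2.3 maps `ra₀ ↦ a` by ≤ 2 real reflections, carrying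
  `rb₀` to `b₁ ⊥ a`, and Prop. 2.3 INSIDE `a^⊥` maps `b₁ ↦ b` fixing `a`; complexified: `r x₀ ↦ x`.
* APPROXIMATION (`exists_intReflections_near`): `(w, u) ↦ s_w u` is jointly continuous at non-isotropic
  `w`, `Λ_ℚ` is dense in `Λ_ℝ`, `s_{Nu} = s_u` (`latticeMultiple`): by induction on the word a LATTICE
  word `g` has `dist (g(r x₀)) x < ε`, and `x' = g(r x₀)` is the witness.
-/

noncomputable section

open scoped Matrix
open Literature.AlgebraicGeometry.Surfaces
open Literature.LinearAlgebra.QuadraticForm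

namespace Summit.HodgeConjecture.HodgeConjecture.Theorems.NikulinTwinTransport.CmNormAnchors

/-! ### Local notations (the line's, bodies verbatim from the skeleton; then this file's) -/
/-- `PeriodPt[x]`: a projective period point. Local notation only, verbatim from the glue files. -/
local notation3 (prettyPrint := false) "PeriodPt[" x "]" =>
  (k3Form x x = 0 ∧ 0 < (k3Form (star x) x).re ∧
    ∃ u : K3Index → ℤ, k3Form (fun i => (u i : ℂ)) x = 0 ∧ 0 < ∑ i, ∑ j, u i * k3Gram i j * u j)
/-- `RatEnd[J]`: the endomorphism `J` of `Λ_ℂ` is defined over `ℚ`. Local notation only. -/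
local notation3 (prettyPrint := false) "RatEnd[" J "]" =>
  ∀ v : K3Index → ℤ, ∃ w : K3Index → ℚ, J (fun i => (v i : ℂ)) = fun i => (w i : ℂ)
/-- `CMNormPeriod[c, x]`: `x` is a CM-norm period of multiplier `c`. Local notation only. -/
local notation3 (prettyPrint := false) "CMNormPeriod[" c ", " x "]" =>
  ∃ (J K : Module.End ℂ (K3Index → ℂ)), RatEnd[J] ∧ RatEnd[K] ∧ J * K = 1 ∧ K * J = 1 ∧
    (∀ a b, k3Form (J a) (J b) = c * k3Form a b) ∧ ∃ t : ℂ, t.im ≠ 0 ∧ J x = t • x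
/-- `CMNormDense[c]`: CM-norm periods of multiplier `c` are dense among period points. Local notation only. -/
local notation3 (prettyPrint := false) "CMNormDense[" c "]" =>
  ∀ x : K3Index → ℂ, PeriodPt[x] → ∀ ε : ℝ, 0 < ε →
    ∃ x' : K3Index → ℂ, PeriodPt[x'] ∧ dist x' x < ε ∧ CMNormPeriod[c, x']
/-- `E₈ ⊗ ℚ` (as in `k3Gram_map_ratCast`). Local notation only. -/
local notation3 (prettyPrint := false) "E8q" => ((CartanMatrix.E₈).map (Int.cast : ℤ → ℚ) : Matrix (Fin 8) (Fin 8) ℚ)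
/-- The rational hyperbolic plane. Local notation only. -/
local notation3 (prettyPrint := false) "UQ" => (hyperbolicPlaneGram.map (Int.cast : ℤ → ℚ) : Matrix (Fin 2) (Fin 2) ℚ)
/-- `diag(1, 16m)` on `U₁` (verbatim from the Lattice toolkit, for `uBlock_conj`). Local notation only. -/
local notation3 (prettyPrint := false) "DU[" m "]" => (!![(1 : ℚ), 0; 0, 16 * m] : Matrix (Fin 2) (Fin 2) ℚ)
/-- The coupling `4C` on `U₂ ⊕ U₃` (`e₂ ↦ 4e₃`, `f₂ ↦ 4m f₃`, `e₃ ↦ −4m e₂`, `f₃ ↦ −4f₂`). Local notation only. -/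
local notation3 (prettyPrint := false) "CC[" m "]" =>
  (Matrix.fromBlocks 0 !![-4 * m, 0; 0, (-4 : ℚ)] !![(4 : ℚ), 0; 0, 4 * m] 0 :
    Matrix (Fin 2 ⊕ Fin 2) (Fin 2 ⊕ Fin 2) ℚ)
/-- `JJ[X, m]`: `E₈`-blocks `X`, `diag(1,16m)` on `U₁`, the coupling on `U₂ ⊕ U₃`. Local notation only. -/
local notation3 (prettyPrint := false) "JJ[" X ", " m "]" =>
  (Matrix.fromBlocks (Matrix.fromBlocks X 0 0 X) 0 0 (Matrix.fromBlocks DU[m] 0 0 CC[m]) :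
    Matrix K3Index K3Index ℚ)
/-- The seed vector `x₀ = s e₂ + s f₂ + i e₃ + i m f₃` (`s = √m`). Local notation only. -/
local notation3 (prettyPrint := false) "xS[" s ", " m "]" =>
  (Sum.elim 0 (Sum.elim 0 (Sum.elim ![((s : ℝ) : ℂ), ((s : ℝ) : ℂ)]
    ![Complex.I, Complex.I * ((m : ℚ) : ℂ)])) : K3Index → ℂ)
/-- The positive lattice vector `u₀ = e₁ + f₁ ∈ U₁`. Local notation only. -/
local notation3 (prettyPrint := false) "uS" => (Sum.elim 0 (Sum.elim ![1, 1] 0) : K3Index → ℤ)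
/-- The real K3 form on `Λ_ℝ` (the `k3RForm_*` lemmas of `K3TwistorLines`). Local notation only. -/
local notation3 (prettyPrint := false) "RB" =>
  (Matrix.toBilin' (k3Gram.map (Int.cast : ℤ → ℝ)) : LinearMap.BilinForm ℝ (K3Index → ℝ))
/-- `rC[v]`: a real vector `v ∈ Λ_ℝ` viewed in `Λ_ℂ`. Local notation only. -/
local notation3 (prettyPrint := false) "rC[" v "]" => (fun i : K3Index => (((v : K3Index → ℝ) i : ℝ) : ℂ))
/-- `sC[w]`: the `ℂ`-linear reflection of `Λ_ℂ` along the REAL vector `w`. Local notation only. -/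
local notation3 (prettyPrint := false) "sC[" w "]" => (reflection k3FormC rC[w] : Module.End ℂ (K3Index → ℂ))

/-! ### The seed: a CM-norm period of every multiplier `n ≥ 1` -/
/-- `(4C)ᵀ (U ⊕ U) (4C) = 16m (U ⊕ U)`: the coupling is a `16m`-similitude of `U₂ ⊕ U₃`. [folklore] -/
theorem cc_conj (m : ℚ) :
    (CC[m])ᵀ * Matrix.fromBlocks UQ 0 0 UQ * CC[m] = (16 * m) • Matrix.fromBlocks UQ 0 0 UQ := by
  ext i j
  rcases i with i | i <;> rcases j with j | j <;> fin_cases i <;> fin_cases j <;>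
    simp [Matrix.fromBlocks_multiply, Matrix.fromBlocks_transpose, Matrix.mul_apply,
      Fin.sum_univ_two, hyperbolicPlaneGram] <;> ring

/-- `JJᵀ Λ_ℚ JJ = 16m Λ_ℚ` as soon as the `E₈`-block `X` satisfies `Xᵀ E₈ X = 16m E₈`. [folklore] -/
theorem jj_conj (X : Matrix (Fin 8) (Fin 8) ℚ) (m : ℚ) (hX : Xᵀ * E8q * X = (16 * m) • E8q) :
    (JJ[X, m])ᵀ * k3Gram.map (Int.cast : ℤ → ℚ) * JJ[X, m] = (16 * m) • k3Gram.map (Int.cast : ℤ → ℚ) := by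
  have hE : Xᵀ * (-E8q) * X = (16 * m) • (-E8q) := by rw [Matrix.mul_neg, Matrix.neg_mul, hX, smul_neg]
  rw [k3Gram_map_ratCast, fromBlocks_diag_conj, fromBlocks_diag_conj, fromBlocks_diag_conj, hE,
    uBlock_conj, cc_conj]
  simp only [Matrix.fromBlocks_smul, smul_zero]

/-- **`J x₀ = −i√m · x₀`** for `J = ¼ JJ ⊗ ℂ`: only the coupling acts on the seed vector. [folklore] -/
theorem j_mulVec_xS (X : Matrix (Fin 8) (Fin 8) ℚ) (m : ℚ) (s : ℝ) (hsm' : ((m : ℚ) : ℂ) = (s : ℂ) * s) :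
    (((4 : ℚ)⁻¹ • JJ[X, m]).map (Rat.castHom ℂ)) *ᵥ xS[s, m] = (-(Complex.I * (s : ℂ))) • xS[s, m] := by
  ext i
  rcases i with i | (i | (i | i))
  · simp [Matrix.mulVec, dotProduct, Fintype.sum_sum_type]
  · fin_cases i <;> simp [Matrix.mulVec, dotProduct, Fintype.sum_sum_type]
  · fin_cases i <;> simp [Matrix.mulVec, dotProduct, Fintype.sum_sum_type, Fin.sum_univ_two, hsm'] <;> ring
  · fin_cases i <;> simp [Matrix.mulVec, dotProduct, Fintype.sum_sum_type, Fin.sum_univ_two]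
    · linear_combination (s : ℂ) * Complex.I_mul_I
    · linear_combination ((m : ℚ) * s : ℂ) * Complex.I_mul_I

/-- **The seed vector is a projective period point**: `x₀² = 0`, `(x̄₀.x₀) = 4m > 0`, `(u₀.x₀) = 0`,
`u₀² = 2`. [cite: Huybrechts2016K3, Ch. 6 §1.1] -/
theorem xS_period (m : ℚ) (s : ℝ) (hs : 0 < s) (hsm' : ((m : ℚ) : ℂ) = (s : ℂ) * s) :
    k3Form xS[s, m] xS[s, m] = 0 ∧ 0 < (k3Form (star xS[s, m]) xS[s, m]).re ∧
      k3Form (fun i => (uS i : ℂ)) xS[s, m] = 0 ∧ 0 < ∑ i, ∑ j, uS i * k3Gram i j * uS j := by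
  refine ⟨?_, ?_, ?_, ?_⟩
  · simp [k3Form, k3Gram, hyperbolicPlaneGram, Fintype.sum_sum_type, Fin.sum_univ_two, hsm']
    linear_combination (2 * (s : ℂ) * s) * Complex.I_mul_I
  · simp [k3Form, k3Gram, hyperbolicPlaneGram, Fintype.sum_sum_type, Fin.sum_univ_two, hsm']
    exact hs.ne'
  · simp [k3Form, k3Gram, hyperbolicPlaneGram, Fintype.sum_sum_type, Fin.sum_univ_two]
  · simp [k3Gram, hyperbolicPlaneGram, Fintype.sum_sum_type, Fin.sum_univ_two]

/-- **CM-norm periods exist for every multiplier `n ≥ 1`**: an explicit projective period point `x₀`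
which is an eigen-period (eigenvalue `−i√n ∉ ℝ`) of a rational `n`-similitude `J = ¼ JJ` of
`(Λ_ℂ, k3Form)` with rational two-sided inverse `K = J⁻¹`. [folklore] -/
theorem exists_cmNormPeriod (n : ℕ) (hn : 0 < n) :
    ∃ x₀ : K3Index → ℂ, PeriodPt[x₀] ∧ CMNormPeriod[((n : ℕ) : ℂ), x₀] := by
  obtain ⟨a, b, c, d, habcd⟩ := Nat.sum_four_squares n
  have hm : (a : ℚ) ^ 2 + (b : ℚ) ^ 2 + (c : ℚ) ^ 2 + (d : ℚ) ^ 2 = (n : ℚ) := by exact_mod_cast habcd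
  have hn0 : (n : ℚ) ≠ 0 := by exact_mod_cast hn.ne'
  obtain ⟨X, hX⟩ : ∃ X : Matrix (Fin 8) (Fin 8) ℚ, Xᵀ * E8q * X = (16 * (n : ℚ)) • E8q :=
    ⟨_, e8Block_conj _ _ _ _ _ hm⟩
  set s : ℝ := Real.sqrt n with hs_def
  have hs : 0 < s := Real.sqrt_pos.2 (by exact_mod_cast hn)
  have hsm' : ((n : ℚ) : ℂ) = (s : ℂ) * s := by
    rw [← Complex.ofReal_mul, hs_def, Real.mul_self_sqrt (Nat.cast_nonneg n)]; simp
  set A : Matrix K3Index K3Index ℚ := (4 : ℚ)⁻¹ • JJ[X, (n : ℚ)] with hA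
  have hAconj : Aᵀ * k3Gram.map (Int.cast : ℤ → ℚ) * A = (n : ℚ) • k3Gram.map (Int.cast : ℤ → ℚ) := by
    rw [hA, Matrix.transpose_smul, smul_mul_assoc, smul_mul_assoc, mul_smul_comm, jj_conj X _ hX,
      smul_smul, smul_smul]
    congr 1
    norm_num
    ring
  have hdet : IsUnit A.det := by
    refine isUnit_iff_ne_zero.2 fun h0 => hn0 ?_
    have h := congrArg Matrix.det hAconj
    rw [Matrix.det_mul, Matrix.det_mul, h0, mul_zero, Matrix.det_smul, ← Int.cast_det, k3Gram_det] at h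
    simp only [Int.cast_neg, Int.cast_one, mul_neg, mul_one, zero_eq_neg, pow_eq_zero_iff', ne_eq] at h
    exact h.1
  refine ⟨xS[s, (n : ℚ)], ?_, Matrix.toLin' (A.map (Rat.castHom ℂ)),
    Matrix.toLin' (A⁻¹.map (Rat.castHom ℂ)), fun v => ⟨A *ᵥ fun i => (v i : ℚ), ?_⟩,
    fun v => ⟨A⁻¹ *ᵥ fun i => (v i : ℚ), ?_⟩, ?_, ?_, fun u w => ?_, -(Complex.I * (s : ℂ)), ?_, ?_⟩
  · obtain ⟨hxx, hpos, hux, huu⟩ := xS_period (n : ℚ) s hs hsm'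
    exact ⟨hxx, hpos, uS, hux, huu⟩
  · rw [Matrix.toLin'_apply, intCast_eq_ratCast_intCast, ratCast_map_mulVec]
  · rw [Matrix.toLin'_apply, intCast_eq_ratCast_intCast, ratCast_map_mulVec]
  · rw [Module.End.mul_eq_comp, ← Matrix.toLin'_mul, ← Matrix.map_mul, Matrix.mul_nonsing_inv A hdet,
      Matrix.map_one _ (map_zero _) (map_one _), Matrix.toLin'_one, Module.End.one_eq_id]
  · rw [Module.End.mul_eq_comp, ← Matrix.toLin'_mul, ← Matrix.map_mul, Matrix.nonsing_inv_mul A hdet,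
      Matrix.map_one _ (map_zero _) (map_one _), Matrix.toLin'_one, Module.End.one_eq_id]
  · have hG : k3Gram.map (Int.cast : ℤ → ℂ) = (k3Gram.map (Int.cast : ℤ → ℚ)).map (Rat.castHom ℂ) := by
      rw [Matrix.map_map]
      exact Matrix.ext fun i j => by simp
    have hC : (A.map (Rat.castHom ℂ))ᵀ * k3Gram.map (Int.cast : ℤ → ℂ) * A.map (Rat.castHom ℂ) =
        (n : ℂ) • k3Gram.map (Int.cast : ℤ → ℂ) := by
      rw [hG, ← Matrix.transpose_map, ← Matrix.map_mul, ← Matrix.map_mul, hAconj,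
        Matrix.map_smul' _ _ _ (map_mul (Rat.castHom ℂ)), map_natCast]
    rw [Matrix.toLin'_apply, Matrix.toLin'_apply, k3Form_eq_dotProduct, k3Form_eq_dotProduct,
      ← Matrix.vecMul_transpose (A.map _) u]
    simp only [Matrix.dotProduct_mulVec, Matrix.vecMul_vecMul, hC, Matrix.vecMul_smul,
      smul_dotProduct, smul_eq_mul]
  · simp only [Complex.neg_im, Complex.mul_im, Complex.I_re, Complex.ofReal_im, mul_zero,
      Complex.I_im, Complex.ofReal_re, one_mul, zero_add]
    exact neg_ne_zero.2 hs.ne'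
  · rw [Matrix.toLin'_apply, hA, j_mulVec_xS X _ s hsm']

/-! ### The orbit lemmas: rescaling and conjugation by words of lattice reflections -/
/-- CM-norm periods are stable under rescaling by `r ∈ ℂ` (same `J`, `K`, `t`). [folklore] -/
theorem cmNormPeriod_smul {c : ℂ} {x : K3Index → ℂ} (r : ℂ) (h : CMNormPeriod[c, x]) :
    CMNormPeriod[c, r • x] := by
  obtain ⟨J, K, hJ, hK, hJK, hKJ, hJc, t, ht, hJx⟩ := h
  exact ⟨J, K, hJ, hK, hJK, hKJ, hJc, t, ht, by rw [map_smul, hJx, smul_comm]⟩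

/-- Reversing the word inverts a product of lattice reflections. [cite: Huybrechts2019, §1.1] -/
theorem prod_k3ReflectionC_reverse_mul (l : List (K3Index → ℤ)) :
    (l.reverse.map k3ReflectionC).prod * (l.map k3ReflectionC).prod = 1 := by
  have h : ∀ l : List (K3Index → ℤ),
      l.map k3ReflectionC = (l.map fun v i => (v i : ℂ)).map (reflection k3FormC) := fun l => by
    rw [List.map_map]; rfl
  rw [h, h, List.map_reverse]
  exact prod_reflections_reverse_mul _

/-- **CM-norm periods are stable under words `g` of reflections along lattice vectors**: `g x` is a
CM-norm period for `(g J g⁻¹, g K g⁻¹)` (`g⁻¹ =` the reversed word), same eigenvalue. [folklore] -/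
theorem cmNormPeriod_prod_k3ReflectionC {c : ℂ} {x : K3Index → ℂ} (l : List (K3Index → ℤ))
    (h : CMNormPeriod[c, x]) : CMNormPeriod[c, (l.map k3ReflectionC).prod x] := by
  obtain ⟨J, K, hJ, hK, hJK, hKJ, hJc, t, ht, hJx⟩ := h
  have hrat : ∀ l : List (K3Index → ℤ), RatEnd[(l.map k3ReflectionC).prod] := fun l v =>
    ⟨(l.map fun w => reflection k3FormRat fun j => (w j : ℚ)).prod fun i => (v i : ℚ), by
      rw [intCast_eq_ratCast_intCast, prod_k3ReflectionC_ratCast]⟩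
  have hg := hrat l; have hg' := hrat l.reverse; have hg'g := prod_k3ReflectionC_reverse_mul l
  have hgi := k3Form_prod_k3ReflectionC l; have hg'i := k3Form_prod_k3ReflectionC l.reverse
  have hgg' : (l.map k3ReflectionC).prod * (l.reverse.map k3ReflectionC).prod = 1 := by
    simpa only [List.reverse_reverse] using prod_k3ReflectionC_reverse_mul l.reverse
  generalize (l.map k3ReflectionC).prod = g at hg hgi hg'g hgg' ⊢
  generalize (l.reverse.map k3ReflectionC).prod = g' at hg' hg'i hg'g hgg'
  refine ⟨g * J * g', g * K * g', ratEnd_mul _ _ (ratEnd_mul _ _ hg hJ) hg',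
    ratEnd_mul _ _ (ratEnd_mul _ _ hg hK) hg', ?_, ?_, fun a b => ?_, t, ht, ?_⟩
  · rw [show g * J * g' * (g * K * g') = g * (J * (g' * g) * K) * g' by simp only [mul_assoc], hg'g,
      mul_one, hJK, mul_one, hgg']
  · rw [show g * K * g' * (g * J * g') = g * (K * (g' * g) * J) * g' by simp only [mul_assoc], hg'g,
      mul_one, hKJ, mul_one, hgg']
  · simp only [Module.End.mul_apply]
    rw [hgi, hJc, hg'i]
  · rw [Module.End.mul_apply, Module.End.mul_apply, ← Module.End.mul_apply g' g x, hg'g,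
      Module.End.one_apply, hJx, map_smul]

/-! ### Real reflections, complexified; transitivity on conformal orthogonal pairs -/
/-- On real vectors the complexified reflection is the real reflection. [cite: Huybrechts2016K3, Ch. 6 §1.1] -/
theorem reflectionC_ofReal (w v : K3Index → ℝ) : sC[w] rC[v] = rC[reflection RB w v] := by
  rw [reflection_apply, reflection_apply, k3FormC_apply, k3FormC_apply, k3Form_ofReal_eq_k3RForm,
    k3Form_ofReal_eq_k3RForm]
  funext i
  simp only [Pi.sub_apply, Pi.smul_apply, smul_eq_mul]
  push_cast
  ring

/-- The same for a word of reflections along real vectors. [cite: Huybrechts2016K3, Ch. 6 §1.1] -/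
theorem prod_reflectionC_ofReal (L : List (K3Index → ℝ)) (v : K3Index → ℝ) :
    (L.map fun w => sC[w]).prod rC[v] = rC[(L.map (reflection RB)).prod v] := by
  induction L with
  | nil => simp
  | cons w L ih =>
    rw [List.map_cons, List.prod_cons, Module.End.mul_apply, ih, reflectionC_ofReal, List.map_cons,
      List.prod_cons, Module.End.mul_apply]

/-- Iversen's Prop. 2.3 inside `z^⊥`: if `⟨e,e⟩ = ⟨f,f⟩ ≠ 0` and `z ⊥ e, f`, a word of reflections along
non-isotropic vectors ORTHOGONAL TO `z` (two suffice) maps `e ↦ f`. [cite: Iversen1992, Ch. I §2 Prop. 2.3] -/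
theorem exists_reflections_apply_eq_ortho {K V : Type*} [Field K] [AddCommGroup V] [Module K V]
    [NeZero (2 : K)] {B : LinearMap.BilinForm K V} (hB : B.IsSymm) {e f z : V}
    (hef : B e e = B f f) (hf : B f f ≠ 0) (he : B z e = 0) (hfz : B z f = 0) :
    ∃ l : List V, (∀ n ∈ l, B n n ≠ 0) ∧ (∀ n ∈ l, B z n = 0) ∧ (l.map (reflection B)).prod e = f := by
  set W : Submodule K V := LinearMap.ker (B z)
  obtain ⟨l, hl, -, hprod⟩ :=
    exists_reflections_apply_eq (hB.restrict W) (e := ⟨e, he⟩) (f := ⟨f, hfz⟩) hef hf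
  refine ⟨l.map fun n : W => (n : V), fun n hn => ?_, fun n hn => ?_, ?_⟩
  · obtain ⟨n', hn', rfl⟩ := List.mem_map.1 hn
    exact hl n' hn'
  · obtain ⟨n', hn', rfl⟩ := List.mem_map.1 hn
    exact n'.2
  · have h := congrArg Subtype.val hprod
    rw [coe_prod_reflections_restrict] at h
    rwa [List.map_map]

/-- **Transitivity on conformal orthogonal pairs**: if `(p, p')`, `(a, b)` are orthogonal pairs of real
vectors with all squares `= ⟨a,a⟩ ≠ 0`, a word of reflections along non-isotropic real vectors (four
suffice) maps `p ↦ a` AND `p' ↦ b` (`p ↦ a` first; then inside `a^⊥`). [cite: Iversen1992, Ch. I §2 Prop. 2.3] -/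
theorem exists_realReflections_pair {p p' a b : K3Index → ℝ} (ha : RB a a ≠ 0)
    (hpp : RB p p = RB a a) (hp' : RB p' p' = RB a a) (hb : RB b b = RB a a)
    (hpp' : RB p p' = 0) (hab : RB a b = 0) :
    ∃ L : List (K3Index → ℝ), (∀ w ∈ L, RB w w ≠ 0) ∧
      (L.map (reflection RB)).prod p = a ∧ (L.map (reflection RB)).prod p' = b := by
  have hsymm : LinearMap.BilinForm.IsSymm RB := ⟨fun u w => k3RForm_comm u w⟩
  obtain ⟨l₁, hl₁, -, h₁⟩ := exists_reflections_apply_eq hsymm (e := p) (f := a) hpp ha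
  have horth := isOrthogonal_prod_reflections hsymm l₁
  have hb₁ : RB ((l₁.map (reflection RB)).prod p') ((l₁.map (reflection RB)).prod p') = RB b b := by
    rw [horth, hp', hb]
  have hab₁ : RB a ((l₁.map (reflection RB)).prod p') = 0 := by
    conv_lhs => rw [← h₁]
    rw [horth, hpp']
  obtain ⟨l₂, hl₂, hl₂a, h₂⟩ := exists_reflections_apply_eq_ortho hsymm (z := a) hb₁ (hb ▸ ha) hab₁ hab
  refine ⟨l₂ ++ l₁, fun w hw => ?_, ?_, ?_⟩
  · rcases List.mem_append.1 hw with h | h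
    exacts [hl₂ w h, hl₁ w h]
  · rw [List.map_append, List.prod_append, Module.End.mul_apply, h₁]
    exact prod_reflections_apply_of_forall_ortho fun n hn => by rw [hsymm.eq]; exact hl₂a n hn
  · rw [List.map_append, List.prod_append, Module.End.mul_apply, h₂]

/-! ### Approximation of real words by lattice words -/
/-- The K3 form is jointly continuous. [folklore] -/
theorem continuous_k3Form {X : Type*} [TopologicalSpace X] {f g : X → K3Index → ℂ}
    (hf : Continuous f) (hg : Continuous g) : Continuous fun x => k3Form (f x) (g x) := by
  unfold k3Form
  fun_prop

/-- `(w, u) ↦ s_w u` is jointly continuous at every non-isotropic real `w`. [folklore] -/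
theorem continuousAt_reflectionC {w : K3Index → ℝ} (hw : RB w w ≠ 0) (u : K3Index → ℂ) :
    ContinuousAt (fun q : (K3Index → ℝ) × (K3Index → ℂ) => sC[q.1] q.2) (w, u) := by
  have hcast : Continuous fun q : (K3Index → ℝ) × (K3Index → ℂ) => rC[q.1] :=
    continuous_pi fun i => Complex.continuous_ofReal.comp ((continuous_apply i).comp continuous_fst)
  have h0 : k3Form rC[w] rC[w] ≠ 0 := by
    rw [k3Form_ofReal_eq_k3RForm]
    exact Complex.ofReal_ne_zero.2 hw
  have h2 : ContinuousAt (fun q : (K3Index → ℝ) × (K3Index → ℂ) =>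
      (2 : ℂ) / k3Form rC[q.1] rC[q.1]) (w, u) :=
    continuousAt_const.div (continuous_k3Form hcast hcast).continuousAt h0
  have hF : ContinuousAt (fun q : (K3Index → ℝ) × (K3Index → ℂ) =>
      q.2 - (2 / k3Form rC[q.1] rC[q.1] * k3Form rC[q.1] q.2) • rC[q.1]) (w, u) :=
    continuousAt_snd.sub
      ((h2.mul (continuous_k3Form hcast continuous_snd).continuousAt).smul hcast.continuousAt)
  refine hF.congr (Filter.Eventually.of_forall fun q => ?_)
  beta_reduce
  rw [reflection_apply, k3FormC_apply, k3FormC_apply]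

/-- `Λ_ℚ` is dense in `Λ_ℝ` (sup metric). [folklore] -/
theorem exists_rat_near (w : K3Index → ℝ) {δ : ℝ} (hδ : 0 < δ) :
    ∃ u : K3Index → ℚ, dist (fun i => ((u i : ℚ) : ℝ)) w < δ := by
  choose u hu using fun i => exists_rat_btwn (show w i - δ < w i + δ by linarith)
  exact ⟨u, (dist_pi_lt_iff hδ).2 fun i => by
    rw [Real.dist_eq, abs_sub_lt_iff]; obtain ⟨h1, h2⟩ := hu i; constructor <;> linarith⟩

/-- The reflection along a RATIONAL vector is the lattice reflection along its lattice multiple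
(`s_{Nu} = s_u`). [cite: Huybrechts2019, §1.1] -/
theorem k3ReflectionC_latticeMultiple (u : K3Index → ℚ) :
    k3ReflectionC (latticeMultiple u) = sC[fun i => ((u i : ℚ) : ℝ)] := by
  have h1 : (fun i => (((u i : ℚ) : ℝ) : ℂ)) = fun i => ((u i : ℚ) : ℂ) :=
    funext fun i => Complex.ofReal_ratCast (u i)
  rw [h1, k3ReflectionC, intCastC_latticeMultiple, reflection_smul]
  exact Nat.cast_ne_zero.2 (prod_den_ne_zero_nat u)

/-- **Lattice words approximate real words**: for a word `L` of non-isotropic real vectors, `z ∈ Λ_ℂ`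
and `ε > 0`, some word `l` of lattice vectors has `(∏ s_l) z` within `ε` of `(∏ s_L) z`. [folklore] -/
theorem exists_intReflections_near (L : List (K3Index → ℝ)) (hL : ∀ w ∈ L, RB w w ≠ 0)
    (z : K3Index → ℂ) {ε : ℝ} (hε : 0 < ε) :
    ∃ l : List (K3Index → ℤ), dist ((l.map k3ReflectionC).prod z) ((L.map fun w => sC[w]).prod z) < ε := by
  induction L generalizing ε with
  | nil => exact ⟨[], by simpa using hε⟩
  | cons w L ih =>
    obtain ⟨δ, hδ, hδε⟩ := Metric.continuousAt_iff.1
      (continuousAt_reflectionC (hL w List.mem_cons_self) ((L.map fun w => sC[w]).prod z)) ε hε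
    obtain ⟨u, hu⟩ := exists_rat_near w hδ
    obtain ⟨l, hl⟩ := ih (fun w' hw' => hL w' (List.mem_cons_of_mem w hw')) hδ
    refine ⟨latticeMultiple u :: l, ?_⟩
    rw [List.map_cons, List.prod_cons, Module.End.mul_apply, k3ReflectionC_latticeMultiple,
      List.map_cons, List.prod_cons, Module.End.mul_apply]
    exact hδε (x := (_, _)) (by rw [Prod.dist_eq]; exact max_lt hu hl)

/-! ### Density from one CM-norm period; the stub -/
/-- **One CM-norm period `x₀` of multiplier `c` makes them dense**: every projective period point
`x = a + ib` is within `ε` of some `x' = g(r x₀)`, `g` a lattice word near a real word `r x₀ ↦ x`. [folklore] -/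
theorem cmNormDense_of_exists {c : ℂ} (h : ∃ x₀ : K3Index → ℂ, PeriodPt[x₀] ∧ CMNormPeriod[c, x₀]) :
    CMNormDense[c] := by
  obtain ⟨x₀, ⟨hxx₀, hpos₀, hu₀⟩, hcm₀⟩ := h
  intro x hx ε hε
  obtain ⟨hxx, hpos, -⟩ := hx
  obtain ⟨hab, haabb, ha⟩ := k3Period_re_im hxx hpos
  obtain ⟨hab₀, haabb₀, ha₀⟩ := k3Period_re_im hxx₀ hpos₀
  set a : K3Index → ℝ := fun i => (x i).re; set b : K3Index → ℝ := fun i => (x i).im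
  set a₀ : K3Index → ℝ := fun i => (x₀ i).re; set b₀ : K3Index → ℝ := fun i => (x₀ i).im
  have hRbb : RB b b = RB a a := by rw [k3RForm_apply, k3RForm_apply]; exact haabb.symm
  have hRa : 0 < RB a a := by rw [k3RForm_apply]; exact ha
  have hRbb₀ : RB b₀ b₀ = RB a₀ a₀ := by rw [k3RForm_apply, k3RForm_apply]; exact haabb₀.symm
  have hRa₀ : 0 < RB a₀ a₀ := by rw [k3RForm_apply]; exact ha₀
  set r : ℝ := Real.sqrt (RB a a / RB a₀ a₀)
  have hrr : r * r = RB a a / RB a₀ a₀ := Real.mul_self_sqrt (div_pos hRa hRa₀).le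
  have hr0 : r ≠ 0 := (Real.sqrt_pos.2 (div_pos hRa hRa₀)).ne'
  have hpp : RB (r • a₀) (r • a₀) = RB a a := by
    rw [LinearMap.BilinForm.smul_left, LinearMap.BilinForm.smul_right, ← mul_assoc, hrr,
      div_mul_cancel₀ _ hRa₀.ne']
  have hp'p' : RB (r • b₀) (r • b₀) = RB a a := by
    rw [LinearMap.BilinForm.smul_left, LinearMap.BilinForm.smul_right, ← mul_assoc, hrr, hRbb₀,
      div_mul_cancel₀ _ hRa₀.ne']
  have hpp' : RB (r • a₀) (r • b₀) = 0 := by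
    rw [LinearMap.BilinForm.smul_left, LinearMap.BilinForm.smul_right, k3RForm_apply, hab₀, mul_zero,
      mul_zero]
  obtain ⟨L, hL, hLp, hLp'⟩ :=
    exists_realReflections_pair hRa.ne' hpp hp'p' hRbb hpp' (by rw [k3RForm_apply]; exact hab)
  have hLx : (L.map fun w => sC[w]).prod (((r : ℝ) : ℂ) • x₀) = x := by
    have hx₀eq : ((r : ℝ) : ℂ) • x₀ = rC[r • a₀] + Complex.I • rC[r • b₀] := by
      funext i
      apply Complex.ext <;> simp [a₀, b₀]
    rw [hx₀eq, map_add, map_smul, prod_reflectionC_ofReal, prod_reflectionC_ofReal, hLp, hLp']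
    funext i
    apply Complex.ext <;> simp [a, b]
  obtain ⟨l, hl⟩ := exists_intReflections_near L hL (((r : ℝ) : ℂ) • x₀) hε
  rw [hLx] at hl
  have hy := Huybrechts_K3_periodSurjective_projective.hypotheses_smul (t := ((r : ℝ) : ℂ))
    (Complex.ofReal_ne_zero.2 hr0) hxx₀ hpos₀ hu₀
  exact ⟨(l.map k3ReflectionC).prod (((r : ℝ) : ℂ) • x₀),
    k3PeriodHypotheses_prod_k3ReflectionC l hy.1 hy.2.1 hy.2.2, hl,
    cmNormPeriod_prod_k3ReflectionC l (cmNormPeriod_smul _ hcm₀)⟩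

/-- **Stub 5 of line `cm-norm-anchors` — CM-norm periods of multiplier `q` are dense among projective
period points, for every prime `q`** (registered statement of `Cruxes.HodgeSimilitudeAlgebraic.CmNormAnchors`):
`exists_cmNormPeriod` + `cmNormDense_of_exists`; primality is not used. [folklore] -/
theorem stub_cmNormPeriods_dense : ∀ q : ℕ, q.Prime → CMNormDense[((q : ℕ) : ℂ)] :=
  fun q hq => cmNormDense_of_exists (exists_cmNormPeriod q hq.pos)

end Summit.HodgeConjecture.HodgeConjecture.Theorems.NikulinTwinTransport.CmNormAnchors

end
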